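import Summits.ValiantsHypothesis.ValiantsHypothesis.Theorems.CommutativityDial
import Literature.Computability.AlgebraicComplexity.PBoundedGrowth
import HarnessLib

/-!
# The sum-of-squares road to `PerNotNcVP` (Hrubeš–Wigderson–Yehudayoff), typed

Decomposition workshop `decomp-valiant`, lens 6 «restricted-models lifting axis», gen 4, move K5a of the
node `CommutativityDial`: the attackable conjunct `A_nc = CommutativityDial.PerNotNcVP` (the ordered
permanent has no polynomial-size noncommutative circuits) has ONE named road in print, and this file types
it over the tree's objects so that it becomes a THEOREM-INPUT child with a NUMERIC statement:

* `bilinearComplexity F f` — HWY's bilinear complexity `𝓑_F(f)` of a biquadratic polynomial `f(X, Y)`: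
  the least `m` with `f = Σ_{l<m} z_l z'_l`, `z_l, z'_l` bilinear in `X = {x_i}`, `Y = {y_j}` (§1.3);
  `sosPoly F k = (Σ x_i²)(Σ y_j²) = SOS_k`; kernel sanity `bilinearComplexity F (sosPoly F k) ≤ k²`
  (`bilinearComplexity_sosPoly_le`, the trivial upper bound; best known: `O(k²/log k)` via
  Radon–Hurwitz, HWY Fact 1.3; best lower bound over `ℤ`: `Ω(k^{6/5})`, HWY Thm 1.10; over `ℂ` nothing
  superlinear is known).
* `SOSBilinearSuperlinear` (`@[conjecture]`, ROAD INPUT — sufficient, NOT necessary, NOT implied by the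
  summit): `𝓑_ℂ(SOS_k) ≥ c·k^{1+ε}` for some `ε, c > 0` — the hypothesis of HWY Thm 1.7.
* `PermNcExpHard` (`@[conjecture]`, intermediate: EXPONENTIAL noncommutative hardness of the ordered
  permanent, `2^n ≤ (size+1)^d` for `n ≥ n₀`) — the conclusion of HWY Thm 1.7 in the tree's circuit model
  (sum gates carry scalar coefficients; converting to HWY's constant-leaf model costs a factor ≤ 3 in size,
  invisible in `2^{Ω(n)}`); STRONGER in rate than `PerNotNcVP`, hence NOT implied by the summit either —
  it is a road node, not a decomposition piece.
* KERNEL EDGE `perNotNcVP_of_permNcExpHard : PermNcExpHard → PerNotNcVP` (exponential beats polynomial,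
  via `not_isPBounded_two_pow`), and the road composition `perNotNcVP_of_sos` under HWY Thm 1.7 supplied
  as the INLINE hypothesis `hHWY : SOSBilinearSuperlinear → PermNcExpHard` (THEOREM-IN-PRINT, not yet
  formalised: its proof is HWY §A–§C, the central-polynomial structure theorem plus the ID_k reduction).

HONEST FRAMING: typing and bookkeeping; the mathematics is HWY10's; nothing here bears on `VP ≠ VNP`.

## References
* [HrubesWigdersonYehudayoff2010] P. Hrubeš, A. Wigderson, A. Yehudayoff, Relationless completeness and
  separations, CCC 2010 / ECCC TR10-021 (journal version: Non-commutative circuits and the sum-of-squares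
  problem, JAMS 24 (2011) [HrubesWigdersonYehudayoff2011]), §1.2–1.3, Fact 1.3, Thm 1.7, Thm 1.10.
* [Burgisser2000] P. Bürgisser, Completeness and Reduction in Algebraic Complexity Theory, Def. 2.1.
-/

namespace Summit.ValiantsHypothesis.ValiantsHypothesis.Theorems.SOSRoad

open MvPolynomial Literature.Computability.AlgebraicComplexity
open Summit.ValiantsHypothesis.ValiantsHypothesis.Theorems.CommutativityDial (ncEval ncPerPoly PerNotNcVP)

section Bilinear

variable (F : Type*) [CommRing F]

/-- The bilinear form `Σ_{i,j} a_{ij} x_i y_j` in the variables `X = inl`, `Y = inr`.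
[cite: HrubesWigdersonYehudayoff2010, §1.3] -/
noncomputable def bilinForm {k : ℕ} (a : Fin k → Fin k → F) : MvPolynomial (Fin k ⊕ Fin k) F :=
  ∑ i : Fin k, ∑ j : Fin k, a i j • (X (Sum.inl i) * X (Sum.inr j))

/-- HWY's BILINEAR COMPLEXITY `𝓑_F(f)`: the least `m` such that `f = Σ_{l<m} z_l · z'_l` with every `z_l`,
`z'_l` a bilinear form in `X, Y` (`sInf`, so `0` by convention when no such expression exists, i.e. when
`f` is not biquadratic). [cite: HrubesWigdersonYehudayoff2010, §1.3] -/
noncomputable def bilinearComplexity {k : ℕ} (f : MvPolynomial (Fin k ⊕ Fin k) F) : ℕ :=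
  sInf {m : ℕ | ∃ a b : Fin m → Fin k → Fin k → F,
    f = ∑ l : Fin m, bilinForm F (a l) * bilinForm F (b l)}

/-- The sum-of-squares polynomial `SOS_k = (x_1² + ⋯ + x_k²)·(y_1² + ⋯ + y_k²)`.
[cite: HrubesWigdersonYehudayoff2010, §1.2 (1.1)] -/
noncomputable def sosPoly (k : ℕ) : MvPolynomial (Fin k ⊕ Fin k) F :=
  (∑ i : Fin k, X (Sum.inl i) ^ 2) * (∑ j : Fin k, X (Sum.inr j) ^ 2)

/-- The indicator coefficient table of the pair `q = (i, j)` gives the bilinear monomial `x_i y_j`.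
[cite: HrubesWigdersonYehudayoff2010, §1.3] -/
theorem bilinForm_single {k : ℕ} (q : Fin k × Fin k) :
    bilinForm F (fun i j => if (i, j) = q then (1 : F) else 0) = X (Sum.inl q.1) * X (Sum.inr q.2) := by
  unfold bilinForm
  rw [← Fintype.sum_prod_type' (f := fun i j =>
    (if (i, j) = q then (1 : F) else 0) • (X (Sum.inl i) * X (Sum.inr j) : MvPolynomial (Fin k ⊕ Fin k) F))]
  simp only [Prod.mk.eta, ite_smul, one_smul, zero_smul, Finset.sum_ite_eq', Finset.mem_univ, if_true]

/-- `SOS_k = Σ_{(i,j)} (x_i y_j)·(x_i y_j)`: an explicit bilinear expression with `k·k` products.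
[cite: HrubesWigdersonYehudayoff2010, §1.2] -/
theorem sosPoly_eq_sum_bilin (k : ℕ) : ∃ a b : Fin (k * k) → Fin k → Fin k → F,
    sosPoly F k = ∑ l, bilinForm F (a l) * bilinForm F (b l) := by
  refine ⟨fun l i j => if (i, j) = finProdFinEquiv.symm l then 1 else 0,
    fun l i j => if (i, j) = finProdFinEquiv.symm l then 1 else 0, ?_⟩
  simp only [bilinForm_single]
  show sosPoly F k = ∑ l : Fin (k * k),
    (fun p : Fin k × Fin k => X (Sum.inl p.1) * X (Sum.inr p.2) * (X (Sum.inl p.1) * X (Sum.inr p.2) :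
      MvPolynomial (Fin k ⊕ Fin k) F)) (finProdFinEquiv.symm l)
  rw [Equiv.sum_comp finProdFinEquiv.symm (fun p : Fin k × Fin k => (X (Sum.inl p.1) * X (Sum.inr p.2) *
    (X (Sum.inl p.1) * X (Sum.inr p.2)) : MvPolynomial (Fin k ⊕ Fin k) F)), Fintype.sum_prod_type]
  unfold sosPoly
  rw [Finset.sum_mul_sum]
  exact Finset.sum_congr rfl fun i _ => Finset.sum_congr rfl fun j _ => by ring

/-- KERNEL SANITY (the trivial upper bound): `𝓑_F(SOS_k) ≤ k²`.
[cite: HrubesWigdersonYehudayoff2010, §1.2] -/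
theorem bilinearComplexity_sosPoly_le (k : ℕ) : bilinearComplexity F (sosPoly F k) ≤ k ^ 2 := by
  rw [sq]
  exact Nat.sInf_le (sosPoly_eq_sum_bilin F k)

end Bilinear

/-- ROAD INPUT (sufficient for `A_nc`, NOT necessary, NOT implied by the summit; OPEN): HWY's hypothesis —
the bilinear complexity of `SOS_k` over `ℂ` is superlinear with a polynomial gap, `𝓑_ℂ(SOS_k) ≥ c·k^{1+ε}`.
Status in print: `k ≤ 𝓑 ≤ 𝓢 ≤ O(k²/log k)` (Radon–Hurwitz, HWY Fact 1.3); `𝓢_ℤ(k) ≥ Ω(k^{6/5})` for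
INTEGER coefficients (HWY Thm 1.10); over `ℂ` no superlinear lower bound is known.
[cite: HrubesWigdersonYehudayoff2010, Thm 1.7] -/
@[conjecture] def SOSBilinearSuperlinear : Prop :=
  ∃ ε : ℝ, 0 < ε ∧ ∃ c : ℝ, 0 < c ∧
    ∀ k : ℕ, c * (k : ℝ) ^ (1 + ε) ≤ (bilinearComplexity ℂ (sosPoly ℂ k) : ℝ)

/-- ROAD NODE (intermediate; STRONGER in rate than `PerNotNcVP`, NOT implied by the summit; OPEN): the
ordered permanent `ncPerPoly n` requires noncommutative fan-in-two circuits of size `2^{Ω(n)}` —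
discretely, `2^n ≤ (size + 1)^d` for all `n ≥ n₀`. This is the conclusion of HWY Thm 1.7 (and of
Thm 1.4/1.8) in the tree's circuit model. [cite: HrubesWigdersonYehudayoff2010, Thm 1.7] -/
@[conjecture] def PermNcExpHard : Prop :=
  ∃ d n₀ : ℕ, ∀ n : ℕ, n₀ ≤ n → ∀ P : ArithCircuit ℂ (Fin n × Fin n), P.IsFanInTwo →
    ncEval P = ncPerPoly n → 2 ^ n ≤ (P.size + 1) ^ d

/-- Growth bookkeeping: a fixed polynomial is eventually below `2^n` (from `not_isPBounded_two_pow`).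
[cite: Burgisser2000, Def. 2.1] -/
theorem exists_poly_lt_two_pow (c d n₀ : ℕ) : ∃ n, n₀ ≤ n ∧ (n ^ c + c + 1) ^ d < 2 ^ n := by
  by_contra h
  simp only [not_exists, not_and, not_lt] at h
  apply not_isPBounded_two_pow
  have hb : IsPBounded fun n => (n ^ c + c + 1) ^ d + 2 ^ n₀ := by
    refine IsPBounded.add_holds (IsPBounded.pow_holds ?_ d) (IsPBounded.const _)
    refine (IsPBounded.iff_exists_le_mul_succ_pow _).2 ⟨c + 2, c, fun n => ?_⟩
    have h1 : n ^ c ≤ (n + 1) ^ c := Nat.pow_le_pow_left (Nat.le_succ n) c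
    have h2 : 1 ≤ (n + 1) ^ c := Nat.one_le_pow _ _ (Nat.succ_pos n)
    nlinarith
  refine hb.mono fun n => ?_
  by_cases hn : n₀ ≤ n
  · exact (h n hn).trans (Nat.le_add_right _ _)
  · exact (Nat.pow_le_pow_right two_pos (not_le.mp hn).le).trans (Nat.le_add_left _ _)

/-- **KERNEL EDGE of the road**: exponential noncommutative hardness of the ordered permanent implies the
dial's conjunct `A_nc = PerNotNcVP` (superpolynomial hardness, i.o.). [cite: HrubesWigdersonYehudayoff2010, Thm 1.7] -/
theorem perNotNcVP_of_permNcExpHard (h : PermNcExpHard) : PerNotNcVP := by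
  obtain ⟨d, n₀, hd⟩ := h
  intro c
  obtain ⟨n, hn₀, hn⟩ := exists_poly_lt_two_pow c d n₀
  refine ⟨n, fun P h2 hP => ?_⟩
  by_contra hs
  rw [not_lt] at hs
  have h4 := hd n hn₀ P h2 hP
  have h3 : (P.size + 1) ^ d ≤ (n ^ c + c + 1) ^ d := Nat.pow_le_pow_left (by omega) d
  omega

/-- **THE ROAD, composed**: HWY Thm 1.7 (supplied as the inline hypothesis `hHWY` — a THEOREM IN PRINT
whose proof, HWY §A–§C, is not yet formalised) turns the numeric conjecture `𝓑_ℂ(SOS_k) ≥ Ω(k^{1+ε})`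
into `A_nc`. [cite: HrubesWigdersonYehudayoff2010, Thm 1.7] -/
theorem perNotNcVP_of_sos (hHWY : SOSBilinearSuperlinear → PermNcExpHard)
    (hSOS : SOSBilinearSuperlinear) : PerNotNcVP :=
  perNotNcVP_of_permNcExpHard (hHWY hSOS)

end Summit.ValiantsHypothesis.ValiantsHypothesis.Theorems.SOSRoad
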